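import Mathlib
import Literature.Geometry.Riemannian.SphericalCylinderEntropy
import Literature.Geometry.Manifold.CylinderSlice
import HarnessLib

/-!
# Ball-mass slack implies superlevel-set slack on the round cylinder `S⁴ × ℝ`

Stub `stub_levelComparison` of line `ball-mass-slack` of the crux `CylinderEntropy.ThinCrossSectionExists`
(`stmt-SmoothPoincare4-7633`), proved with its registered statement verbatim.

On `N = {z ∈ ℝ⁶ | ∑_{i<5} zᵢ² = 1}` with intrinsic distance `d_N(y,p) = √(arccos⟨y',p'⟩² + (y₅-p₅)²)`:
if `S ⊆ N` satisfies `μH⁴(S ∩ B̄ᴺ(q,r)) ≤ Λ·μH⁴(slice₀ ∩ B̄ᴺ(e₀,r))` for all `q ∈ N`, `r > 0`, and `F` is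
antitone, then `μH⁴(S ∩ {t < F ∘ d_N(·,p)}) ≤ Λ·μH⁴(slice₀ ∩ {t < F ∘ d_N(·,e₀)})` for every `p ∈ N`, `t`.

Proof.  The set `J = {s ≥ 0 | t < F s}` is a lower set of `[0,∞)`.  If it is empty the left side is the
measure of `∅`.  Otherwise (`LevelComparison.exists_exhausting_seq`) there is a monotone sequence
`r n ∈ J` exhausting `J` (`r n = n` if `J` is unbounded, `r n = sup J` if the supremum is attained,
and a strictly increasing sequence converging to `sup J` from `IsLUB.exists_seq_strictMono_tendsto_of_notMem`
otherwise), so `S ∩ {t < F ∘ d_N}` is the increasing union of the closed intrinsic balls of radii `r n`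
and continuity from below (`Monotone.measure_iUnion`, no measurability needed) reduces the claim to the
ball hypothesis (`LevelComparison.measure_level_le_of_seq`, stated for an arbitrary measure and arbitrary
"squared distance" functions).  The radius `r = 0` is not covered by the hypothesis; there the ball
`{y ∈ N | d_N(y,p)² ≤ 0}` is contained in `{p}` (`LevelComparison.eq_of_sqDist_nonpos`: `arccos⟨y',p'⟩ = 0`
forces `⟨y',p'⟩ ≥ 1`, hence `y' = p'` for unit vectors, and `y₅ = p₅`), which is `μH⁴`-null
(`MeasureTheory.Measure.nullSingletonClass_hausdorff`).

Everything here is proved; no facts and no `Prop`-valued definitions are introduced.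
-/

noncomputable section

open scoped BigOperators Topology MeasureTheory ENNReal NNReal
open Set Function MeasureTheory
open Literature.Geometry.Riemannian.SphericalCylinderEntropy (cylEntropy cylDensity cylKernel zonal wt gegen
  cylKernel_eq abs_sum_mul_le_one hausdorffMeasure_sphere_four_pos hausdorffMeasure_sphere_four_lt_top)
open Literature.Geometry.Manifold.CylinderSlice (sliceMap range_sliceMap)

set_option linter.dupNamespace false

namespace Summit.SmoothPoincare4.SmoothPoincare4.Theorems.ThinCrossSectionExists.BallMassSlack

namespace LevelComparison

/-- Continuity from below along an exhausting sequence of radii: if `r n ≥ 0` is monotone, every `r n`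
lies in the superlevel set `{s | t < F s}` of the antitone `F`, and every `s ≥ 0` with `t < F s` is
below some `r n`, then the ball comparison `μ(S ∩ {P ∧ g₁ ≤ r²}) ≤ Λ·μ(T ∩ {P ∧ g₂ ≤ r²})` (`r ≥ 0`)
implies the superlevel comparison `μ(S ∩ {t < F √g₁}) ≤ Λ·μ(T ∩ {t < F √g₂})`. [folklore] -/
theorem measure_level_le_of_seq {α : Type*} [MeasurableSpace α] (μ : Measure α) (Λ : ℝ≥0∞)
    (S T : Set α) (P : α → Prop) (g₁ g₂ : α → ℝ) (F : ℝ → ℝ) (t : ℝ)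
    (hS : ∀ y ∈ S, P y)
    (H : ∀ r : ℝ, 0 ≤ r →
      μ (S ∩ {y | P y ∧ g₁ y ≤ r ^ 2}) ≤ Λ * μ (T ∩ {y | P y ∧ g₂ y ≤ r ^ 2}))
    (hF : Antitone F) (r : ℕ → ℝ) (hr0 : ∀ n, 0 ≤ r n) (hrm : Monotone r)
    (hrJ : ∀ n, t < F (r n)) (hex : ∀ s : ℝ, 0 ≤ s → t < F s → ∃ n, s ≤ r n) :
    μ (S ∩ {y | t < F (Real.sqrt (g₁ y))}) ≤ Λ * μ (T ∩ {y | t < F (Real.sqrt (g₂ y))}) := by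
  have hsq : ∀ (n : ℕ) (x : ℝ), x ≤ r n ^ 2 → Real.sqrt x ≤ r n := fun n x hx =>
    (Real.sqrt_le_sqrt hx).trans_eq (Real.sqrt_sq (hr0 n))
  have hcover : S ∩ {y | t < F (Real.sqrt (g₁ y))} = ⋃ n, S ∩ {y | P y ∧ g₁ y ≤ r n ^ 2} := by
    ext y
    simp only [mem_inter_iff, mem_setOf_eq, mem_iUnion]
    constructor
    · rintro ⟨hyS, hyt⟩
      obtain ⟨n, hn⟩ := hex _ (Real.sqrt_nonneg _) hyt
      exact ⟨n, hyS, hS y hyS, (Real.sqrt_le_left (hr0 n)).1 hn⟩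
    · rintro ⟨n, hyS, -, hyn⟩
      exact ⟨hyS, (hrJ n).trans_le (hF (hsq n _ hyn))⟩
  have hmono : Monotone fun n => S ∩ {y | P y ∧ g₁ y ≤ r n ^ 2} := by
    intro n m hnm y hy
    exact ⟨hy.1, hy.2.1, hy.2.2.trans (pow_le_pow_left₀ (hr0 n) (hrm hnm) 2)⟩
  rw [hcover, hmono.measure_iUnion]
  refine iSup_le fun n => (H (r n) (hr0 n)).trans (mul_le_mul_right (measure_mono ?_) Λ)
  rintro y ⟨hyT, -, hyn⟩
  exact ⟨hyT, (hrJ n).trans_le (hF (hsq n _ hyn))⟩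

/-- The nonnegative part `J = {s ≥ 0 | t < F s}` of a superlevel set of an antitone function is a lower
set of `[0,∞)`; if it contains `0` it is exhausted by a monotone sequence of its elements (`n ↦ n` if
`J` is unbounded, the constant `sup J` if the supremum is attained, a sequence increasing to `sup J`
otherwise). [folklore] -/
theorem exists_exhausting_seq (F : ℝ → ℝ) (t : ℝ) (hF : Antitone F) (h0 : t < F 0) :
    ∃ r : ℕ → ℝ, (∀ n, 0 ≤ r n) ∧ Monotone r ∧ (∀ n, t < F (r n)) ∧
      ∀ s : ℝ, 0 ≤ s → t < F s → ∃ n, s ≤ r n := by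
  set J : Set ℝ := {s | 0 ≤ s ∧ t < F s} with hJ
  have h0J : (0 : ℝ) ∈ J := ⟨le_rfl, h0⟩
  by_cases hb : BddAbove J
  · have hR0 : 0 ≤ sSup J := le_csSup hb h0J
    by_cases hRJ : t < F (sSup J)
    · exact ⟨fun _ => sSup J, fun _ => hR0, monotone_const, fun _ => hRJ,
        fun s hs hst => ⟨0, le_csSup hb ⟨hs, hst⟩⟩⟩
    · have hRJ' : sSup J ∉ J := fun h => hRJ h.2
      obtain ⟨u, humono, -, hut, huJ⟩ :=
        (isLUB_csSup ⟨0, h0J⟩ hb).exists_seq_strictMono_tendsto_of_notMem hRJ' ⟨0, h0J⟩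
      refine ⟨u, fun n => (huJ n).1, humono.monotone, fun n => (huJ n).2, fun s hs hst => ?_⟩
      have hsR : s < sSup J :=
        lt_of_le_of_ne (le_csSup hb ⟨hs, hst⟩) fun h => hRJ' (h ▸ ⟨hs, hst⟩)
      obtain ⟨n, hn⟩ := (hut.eventually (lt_mem_nhds hsR)).exists
      exact ⟨n, hn.le⟩
  · rw [not_bddAbove_iff] at hb
    refine ⟨fun n => n, fun n => n.cast_nonneg, Nat.mono_cast, fun n => ?_,
      fun s _ _ => ⟨⌈s⌉₊, Nat.le_ceil s⟩⟩
    obtain ⟨x, hxJ, hnx⟩ := hb n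
    exact hxJ.2.trans_le (hF hnx.le)

/-- BALL COMPARISON ⇒ SUPERLEVEL COMPARISON, abstract form: for any measure `μ`, any "squared
distance" functions `g₁, g₂`, any antitone profile `F` and level `t`, the comparison of closed balls
`μ(S ∩ {P ∧ g₁ ≤ r²}) ≤ Λ·μ(T ∩ {P ∧ g₂ ≤ r²})` for all `r ≥ 0` (with `S ⊆ P`) gives
`μ(S ∩ {t < F √g₁}) ≤ Λ·μ(T ∩ {t < F √g₂})`. [folklore] -/
theorem measure_level_le {α : Type*} [MeasurableSpace α] (μ : Measure α) (Λ : ℝ≥0∞)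
    (S T : Set α) (P : α → Prop) (g₁ g₂ : α → ℝ) (F : ℝ → ℝ) (t : ℝ)
    (hS : ∀ y ∈ S, P y)
    (H : ∀ r : ℝ, 0 ≤ r →
      μ (S ∩ {y | P y ∧ g₁ y ≤ r ^ 2}) ≤ Λ * μ (T ∩ {y | P y ∧ g₂ y ≤ r ^ 2}))
    (hF : Antitone F) :
    μ (S ∩ {y | t < F (Real.sqrt (g₁ y))}) ≤ Λ * μ (T ∩ {y | t < F (Real.sqrt (g₂ y))}) := by
  by_cases h0 : t < F 0
  · obtain ⟨r, hr0, hrm, hrJ, hex⟩ := exists_exhausting_seq F t hF h0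
    exact measure_level_le_of_seq μ Λ S T P g₁ g₂ F t hS H hF r hr0 hrm hrJ hex
  · have hzero : μ (S ∩ {y | t < F (Real.sqrt (g₁ y))}) = 0 :=
      measure_mono_null (fun y hy => (h0 (hy.2.trans_le (hF (Real.sqrt_nonneg _)))).elim)
        measure_empty
    rw [hzero]
    exact zero_le

/-- Two points of `N` at intrinsic squared distance `≤ 0` coincide: `arccos⟨y',p'⟩ = 0` gives
`⟨y',p'⟩ ≥ 1`, so `∑ (yᵢ - pᵢ)² = 2 - 2⟨y',p'⟩ ≤ 0` for the unit vectors `y', p'`, and `y₅ = p₅`. [folklore] -/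
theorem eq_of_sqDist_nonpos (y p : EuclideanSpace ℝ (Fin 6))
    (hy : ∑ i : Fin 5, y (Fin.castSucc i) ^ 2 = 1) (hp : ∑ i : Fin 5, p (Fin.castSucc i) ^ 2 = 1)
    (h : Real.arccos (∑ i : Fin 5, y (Fin.castSucc i) * p (Fin.castSucc i)) ^ 2 + (y 5 - p 5) ^ 2 ≤ 0) :
    y = p := by
  have ha2 := sq_nonneg (Real.arccos (∑ i : Fin 5, y (Fin.castSucc i) * p (Fin.castSucc i)))
  have h52 := sq_nonneg (y 5 - p 5)
  have ha : Real.arccos (∑ i : Fin 5, y (Fin.castSucc i) * p (Fin.castSucc i)) = 0 :=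
    sq_eq_zero_iff.1 (le_antisymm (by linarith) ha2)
  have h5 : y 5 = p 5 := sub_eq_zero.1 (sq_eq_zero_iff.1 (le_antisymm (by linarith) h52))
  have hinner : 1 ≤ ∑ i : Fin 5, y (Fin.castSucc i) * p (Fin.castSucc i) := Real.arccos_eq_zero.1 ha
  have hsum : ∑ i : Fin 5, (y (Fin.castSucc i) - p (Fin.castSucc i)) ^ 2 = 0 := by
    refine le_antisymm ?_ (Finset.sum_nonneg fun i _ => sq_nonneg _)
    have hexp : ∑ i : Fin 5, (y (Fin.castSucc i) - p (Fin.castSucc i)) ^ 2 =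
        ∑ i : Fin 5, y (Fin.castSucc i) ^ 2 + ∑ i : Fin 5, p (Fin.castSucc i) ^ 2 -
          2 * ∑ i : Fin 5, y (Fin.castSucc i) * p (Fin.castSucc i) := by
      rw [Finset.mul_sum, ← Finset.sum_add_distrib, ← Finset.sum_sub_distrib]
      exact Finset.sum_congr rfl fun i _ => by ring
    rw [hexp, hy, hp]
    linarith
  have hcoord : ∀ i : Fin 5, y (Fin.castSucc i) = p (Fin.castSucc i) := fun i =>
    sub_eq_zero.1 (sq_eq_zero_iff.1
      ((Finset.sum_eq_zero_iff_of_nonneg fun j _ =>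
        sq_nonneg (y (Fin.castSucc j) - p (Fin.castSucc j))).1 hsum i (Finset.mem_univ i)))
  ext j
  induction j using Fin.lastCases with
  | last => exact h5
  | cast i => exact hcoord i

/-- The closed intrinsic ball of radius `0` about `p ∈ N` meets any `S` in a `μH⁴`-null set: it is
contained in `{p}` (`eq_of_sqDist_nonpos`) and `μH⁴` has no atoms. [folklore] -/
theorem measure_ball_zero (S : Set (EuclideanSpace ℝ (Fin 6))) (p : EuclideanSpace ℝ (Fin 6))
    (hp : ∑ i : Fin 5, p (Fin.castSucc i) ^ 2 = 1) :
    μH[4] (S ∩ {y : EuclideanSpace ℝ (Fin 6) | ∑ i : Fin 5, y (Fin.castSucc i) ^ 2 = 1 ∧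
      Real.arccos (∑ i : Fin 5, y (Fin.castSucc i) * p (Fin.castSucc i)) ^ 2 + (y 5 - p 5) ^ 2 ≤
        (0 : ℝ) ^ 2}) = 0 := by
  haveI := Measure.nullSingletonClass_hausdorff (EuclideanSpace ℝ (Fin 6)) (by norm_num : (0 : ℝ) < 4)
  have h00 : (0 : ℝ) ^ 2 = 0 := by norm_num
  refine Set.Subsingleton.measure_zero ?_ _
  rintro y ⟨-, hyN, hy⟩ z ⟨-, hzN, hz⟩
  rw [eq_of_sqDist_nonpos y p hyN hp (hy.trans_eq h00), eq_of_sqDist_nonpos z p hzN hp (hz.trans_eq h00)]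

end LevelComparison

/-- STUB C-level of line `ball-mass-slack`: BALL-MASS SLACK ⇒ LEVEL-SET SLACK.  If `S ⊆ N` has
`Λ`-subspherical intrinsic ball mass (`μH⁴(S ∩ B̄ᴺ(q,r)) ≤ Λ·μH⁴(slice₀ ∩ B̄ᴺ(e₀,r))` for all `q ∈ N`,
`r > 0`) and `F : ℝ → ℝ` is antitone, then for every centre `p ∈ N` and level `t`,
`μH⁴(S ∩ {F(d_N(·,p)) > t}) ≤ Λ·μH⁴(slice₀ ∩ {F(d_N(·,e₀)) > t})`.  Proof: `LevelComparison.measure_level_le`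
(lower-set exhaustion + continuity from below) with the radius-`0` ball handled by
`LevelComparison.measure_ball_zero`. [folklore] -/
theorem stub_levelComparison :
    ∀ (Λ : ℝ≥0∞) (S : Set (EuclideanSpace ℝ (Fin 6))) (F : ℝ → ℝ) (p : EuclideanSpace ℝ (Fin 6)) (t : ℝ),
      (∀ y ∈ S, ∑ i : Fin 5, y (Fin.castSucc i) ^ 2 = 1) →
      (∀ p : EuclideanSpace ℝ (Fin 6), ∑ i : Fin 5, p (Fin.castSucc i) ^ 2 = 1 → ∀ r : ℝ, 0 < r →
          μH[4] (S ∩ {y : EuclideanSpace ℝ (Fin 6) | ∑ i : Fin 5, y (Fin.castSucc i) ^ 2 = 1 ∧ Real.arccos (∑ i : Fin 5, y (Fin.castSucc i) * p (Fin.castSucc i)) ^ 2 + (y 5 - p 5) ^ 2 ≤ r ^ 2}) ≤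
            Λ * μH[4] ({z : EuclideanSpace ℝ (Fin 6) | ∑ i : Fin 5, z (Fin.castSucc i) ^ 2 = 1 ∧ z 5 = 0} ∩
              {y : EuclideanSpace ℝ (Fin 6) | ∑ i : Fin 5, y (Fin.castSucc i) ^ 2 = 1 ∧ Real.arccos (∑ i : Fin 5, y (Fin.castSucc i) * (EuclideanSpace.single 0 1 : EuclideanSpace ℝ (Fin 6)) (Fin.castSucc i)) ^ 2 + (y 5 - (EuclideanSpace.single 0 1 : EuclideanSpace ℝ (Fin 6)) 5) ^ 2 ≤ r ^ 2})) →
      Antitone F → ∑ i : Fin 5, p (Fin.castSucc i) ^ 2 = 1 →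
        μH[4] (S ∩ {y : EuclideanSpace ℝ (Fin 6) | t < F (Real.sqrt (Real.arccos (∑ i : Fin 5, y (Fin.castSucc i) * p (Fin.castSucc i)) ^ 2 + (y 5 - p 5) ^ 2))}) ≤
            Λ * μH[4] ({z : EuclideanSpace ℝ (Fin 6) | ∑ i : Fin 5, z (Fin.castSucc i) ^ 2 = 1 ∧ z 5 = 0} ∩ {y : EuclideanSpace ℝ (Fin 6) | t < F (Real.sqrt (Real.arccos (∑ i : Fin 5, y (Fin.castSucc i) * (EuclideanSpace.single 0 1 : EuclideanSpace ℝ (Fin 6)) (Fin.castSucc i)) ^ 2 + (y 5 - (EuclideanSpace.single 0 1 : EuclideanSpace ℝ (Fin 6)) 5) ^ 2))}) := by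
  intro Λ S F p t hS hH hF hp
  refine LevelComparison.measure_level_le μH[4] Λ S _
    (fun y : EuclideanSpace ℝ (Fin 6) => ∑ i : Fin 5, y (Fin.castSucc i) ^ 2 = 1)
    (fun y : EuclideanSpace ℝ (Fin 6) =>
      Real.arccos (∑ i : Fin 5, y (Fin.castSucc i) * p (Fin.castSucc i)) ^ 2 + (y 5 - p 5) ^ 2)
    (fun y : EuclideanSpace ℝ (Fin 6) =>
      Real.arccos (∑ i : Fin 5, y (Fin.castSucc i) *
        (EuclideanSpace.single 0 1 : EuclideanSpace ℝ (Fin 6)) (Fin.castSucc i)) ^ 2 +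
        (y 5 - (EuclideanSpace.single 0 1 : EuclideanSpace ℝ (Fin 6)) 5) ^ 2)
    F t hS ?_ hF
  intro r hr
  rcases hr.eq_or_lt with rfl | hr'
  · exact (LevelComparison.measure_ball_zero S p hp).trans_le zero_le
  · exact hH p hp r hr'

end Summit.SmoothPoincare4.SmoothPoincare4.Theorems.ThinCrossSectionExists.BallMassSlack

end
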